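import Summits.QuantumFields.YangMills.Theorems.FluctuationComparisonRegPrIntLS2BetaSeamSectorMinimisers
import Summits.QuantumFields.YangMills.Theorems.FluctuationComparisonRegPrIntLS2BetaFlatGapOfIsolated
import HarnessLib

/-!
# (RG-K) THE ℤ₂ SEAM TWIST, VII — EXW∘ (THE WINDOW-EXACTNESS ORGAN OF LINE S2β) HOLDS OUTRIGHT AT EVERY CASE-B WINDOW DATUM: the regular minimum
# there is `0`, it lies below every history, and it is ATTAINED by a good, (6)-regular history — the flat representative `(liftTransfTo g) • ζ_l^K`

Helper for crux `stmt-QuantumFields-20520` (`Theses.UnitScaleTilt.FluctuationComparisonRegPrIntL`), the (T)-chain of LINE `semiclassical_s2beta` (cell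
`ym3-torus`, width seat «width 16» px16 g18).  The registered stub `stub_windowExactness : WindowExactness` asks, at every interior-window datum `V`, for
(E1) `∀ U ∈ fibre V ∩ histGood, minActionRegPr ε₀ V ≤ A(U)` and (E2) `∃ U₀ ∈ regFibrePr ε₀ V ∩ histGood, A(U₀) = minActionRegPr ε₀ V`.  On the CASE-B stratum
(✓part V `exists_gauge_seamFold_of_loopHol_central`: `V = g • ζ_l^J`) both clauses are ELEMENTARY: the flat representative is a (6)-regular member of the
fibre (✓part VI `seamSectorRep_mem_regFibrePr`), has action `0`, so the regular minimum VANISHES; every action is `≥ 0`; and the flat representative is a good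
history as soon as the thresholds are positive (✓`one_mem_histGood_θBal`, the seam twists and gauge transformations preserve `histGood`).

* §1 `mem_histGood_seamFold_iff` (induction over ✓`mem_histGood_seamTwist_iff`), `seamSectorRep_mem_histGood`, `wilsonAction4_seamSectorRep`,
  ★ `minActionRegPr_seamSector_eq_zero`.
* §2 ★★★ `minActionRegPr_eq_zero_of_loopHol_central` — at every case-B `2`-small datum the regular minimum of print's problem (5)–(6) is `0` (`ε₀ > 0`);
  ★★★★ `windowExactness_caseB` — (E1) ∧ (E2) at every case-B `2`-small datum, for EVERY `0 < γ ≤ 1`, `0 < b₀`, `p₀`, `0 < ε₀`, every `J ≤ K`, every `L`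
  (the stub's body at the datum, binders VERBATIM: `fibre`, `histGood (θBal F.L γ b₀ p₀) K J`, `regFibrePr`, `minActionRegPr`).

HONEST: composition of landed letters; nothing of Bałaban's analysis; EXW∘ at case-A and irreducible data ([Balaban1985Variational] Thm 1's existence clause with
its thresholds) is NOT touched; this file proves NO stub of the line as registered (the stub quantifies over ALL interior-window data) — EXW∘, GAP♯∘, TUBE-REG∘,
S2β and crux 20520 stay OPEN; rung R3 (YM₃ on T³) is NOT d = 4, NOT infinite volume, NOT a mass gap, NOT Clay; the Yang–Mills mass gap is NOT proved.
-/

set_option autoImplicit false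

noncomputable section

open Set Function
open scoped Matrix.Norms.L2Operator
open Literature.MathematicalPhysics.QuantumFieldTheory.Balaban1983to89
open Literature.MathematicalPhysics.QuantumFieldTheory.Balaban1983to89.T4Continuum
open Literature.MathematicalPhysics.QuantumFieldTheory.Balaban1983to89.T3ContinuumYM3Torus
open Literature.MathematicalPhysics.QuantumFieldTheory.Balaban1983to89.T3UnitLawDensityEML (ℰp)
open Literature.MathematicalPhysics.QuantumFieldTheory.Balaban1983to89.T3UnitScaleTilt
open Literature.MathematicalPhysics.QuantumFieldTheory.Balaban1983to89.T3TiltDescent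
open Literature.MathematicalPhysics.QuantumFieldTheory.Balaban1983to89.T3ConstrainedMinimiser (fibre)
open Literature.MathematicalPhysics.QuantumFieldTheory.Balaban1983to89.T3PrintedRegularMinimiser
open Literature.MathematicalPhysics.QuantumFieldTheory.Balaban1983to89.T3PrintedRegularOrbits
open Summit.QuantumFields.YangMills.Theorems.FluctuationComparisonRegPrIntLS2BetaResidualGauge (gaugeAct_mem_histGood_iff wilsonAction4_gaugeAct)
open Summit.QuantumFields.YangMills.Theorems.FluctuationComparisonRegPrIntLS2BetaCriticalOrbitUnique (negOne_mul_comm negOne_mul_negOne)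
open Summit.QuantumFields.YangMills.Theorems.BrascampLiebVacuumSC.DimensionGapSU2 (neg_one_mem)
open Summit.QuantumFields.YangMills.Theorems.FluctuationComparisonRegPrIntLS2BetaSeamTwistDescent (mem_histGood_seamTwist_iff)
open Summit.QuantumFields.YangMills.Theorems.FluctuationComparisonRegPrIntLS2BetaTubeLettersSeamSectors (wilsonAction4_seamFold_one)
open Summit.QuantumFields.YangMills.Theorems.FluctuationComparisonRegPrIntLS2BetaSeamSectorNormalForm (exists_gauge_seamFold_of_loopHol_central)
open Summit.QuantumFields.YangMills.Theorems.FluctuationComparisonRegPrIntLS2BetaSeamSectorMinimisers (seamSectorRep_mem_regFibrePr)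
open Summit.QuantumFields.YangMills.Theorems.FluctuationComparisonRegPrIntLS2BetaFlatGapOfIsolated (one_mem_histGood_θBal)

namespace Summit.QuantumFields.YangMills.Theorems.FluctuationComparisonRegPrIntLS2BetaSeamSectorExactness

variable (F : T3Family) {J K : ℕ}

/-! ## §1 The flat representative is a good history of zero action -/

/-- The iterated seam twist preserves the good histories (induction over ✓`mem_histGood_seamTwist_iff`). [cite: Balaban1985UV3, (7) p.257] -/
theorem mem_histGood_seamFold_iff (θ : ℕ → ℝ) (n : ℕ) (U : GaugeField (F.P K) 0 (Matrix.specialUnitaryGroup (Fin 2) ℂ)) :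
    ∀ l : List (Fin 3), (l.foldr (fun (ν : Fin 3) (X : GaugeField (F.P K) 0 (Matrix.specialUnitaryGroup (Fin 2) ℂ)) => fun b : PBond (F.P K) 0 =>
            (if b.dir = ν ∧ (b.src ν).val + 1 = (F.P K).sitesPerDir 0 then (⟨-1, neg_one_mem⟩ : Matrix.specialUnitaryGroup (Fin 2) ℂ) else 1) * X b) U) ∈ histGood F ℰp θ K n ↔ U ∈ histGood F ℰp θ K n
  | [] => Iff.rfl
  | ν :: l => by
    rw [List.foldr_cons]
    exact (mem_histGood_seamTwist_iff F ℰp _ negOne_mul_comm negOne_mul_negOne ν θ n _).trans (mem_histGood_seamFold_iff θ n U l)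

/-- **The flat representative is a good history** whenever the thresholds are positive (`0 < γ ≤ 1`, `0 < b₀`). [cite: Balaban1985UV3, (7) p.257] -/
theorem seamSectorRep_mem_histGood (hJK : J ≤ K) {γ b₀ : ℝ} (hγ : 0 < γ) (hγ1 : γ ≤ 1) (hb : 0 < b₀) (p₀ : ℝ)
    (g : GaugeTransf (F.P J) 0 (Matrix.specialUnitaryGroup (Fin 2) ℂ)) (l : List (Fin 3)) :
    (GaugeField.gaugeAct (liftTransfTo F J K hJK g) (l.foldr (fun (ν : Fin 3) (X : GaugeField (F.P K) 0 (Matrix.specialUnitaryGroup (Fin 2) ℂ)) => fun b : PBond (F.P K) 0 =>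
            (if b.dir = ν ∧ (b.src ν).val + 1 = (F.P K).sitesPerDir 0 then (⟨-1, neg_one_mem⟩ : Matrix.specialUnitaryGroup (Fin 2) ℂ) else 1) * X b) (1 : GaugeField (F.P K) 0 (Matrix.specialUnitaryGroup (Fin 2) ℂ)))) ∈ histGood F ℰp (θBal F.L γ b₀ p₀) K J := by
  rw [gaugeAct_mem_histGood_iff, mem_histGood_seamFold_iff]
  exact one_mem_histGood_θBal F hγ hγ1 hb p₀ K J

/-- The flat representative has zero action. [cite: Balaban1985Variational, (5) p.278] -/
theorem wilsonAction4_seamSectorRep (hJK : J ≤ K) (g : GaugeTransf (F.P J) 0 (Matrix.specialUnitaryGroup (Fin 2) ℂ)) (l : List (Fin 3)) :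
    wilsonAction4 (GaugeField.gaugeAct (liftTransfTo F J K hJK g) (l.foldr (fun (ν : Fin 3) (X : GaugeField (F.P K) 0 (Matrix.specialUnitaryGroup (Fin 2) ℂ)) => fun b : PBond (F.P K) 0 =>
            (if b.dir = ν ∧ (b.src ν).val + 1 = (F.P K).sitesPerDir 0 then (⟨-1, neg_one_mem⟩ : Matrix.specialUnitaryGroup (Fin 2) ℂ) else 1) * X b) (1 : GaugeField (F.P K) 0 (Matrix.specialUnitaryGroup (Fin 2) ℂ)))) = 0 := by
  rw [wilsonAction4_gaugeAct, wilsonAction4_seamFold_one]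

/-- ★ **The regular minimum over every sector datum `g • ζ_l^J` VANISHES** (`ε₀ > 0`). [cite: Balaban1985Variational, (5)-(6) p.278, Thm 1 (8) p.279] -/
theorem minActionRegPr_seamSector_eq_zero (hJK : J ≤ K) {ε₀ : ℝ} (hε₀ : 0 < ε₀) (g : GaugeTransf (F.P J) 0 (Matrix.specialUnitaryGroup (Fin 2) ℂ)) (l : List (Fin 3)) :
    minActionRegPr F J K hJK ε₀ (GaugeField.gaugeAct g (l.foldr (fun (ν : Fin 3) (X : GaugeField (F.P J) 0 (Matrix.specialUnitaryGroup (Fin 2) ℂ)) => fun c : PBond (F.P J) 0 =>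
            (if c.dir = ν ∧ (c.src ν).val + 1 = (F.P J).sitesPerDir 0 then (⟨-1, neg_one_mem⟩ : Matrix.specialUnitaryGroup (Fin 2) ℂ) else 1) * X c) (1 : GaugeField (F.P J) 0 (Matrix.specialUnitaryGroup (Fin 2) ℂ)))) = 0 :=
  le_antisymm ((minActionRegPr_le F (seamSectorRep_mem_regFibrePr F hJK hε₀ g l)).trans_eq (wilsonAction4_seamSectorRep F hJK g l))
    (minActionRegPr_nonneg F _)

/-! ## §2 EXW∘ at every case-B window datum -/

/-- ★★★ **AT EVERY CASE-B `2`-SMALL DATUM THE REGULAR MINIMUM OF PRINT'S PROBLEM (5)–(6) IS `0`** (`ε₀ > 0`; ✓part V normal form). [cite: Balaban1985Variational, (5)-(6) p.278, Thm 1 (8) p.279] -/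
theorem minActionRegPr_eq_zero_of_loopHol_central (hJK : J ≤ K) {ε₀ : ℝ} (hε₀ : 0 < ε₀)
    (V : GaugeField (F.P J) 0 (Matrix.specialUnitaryGroup (Fin 2) ℂ)) (x₀ : Site (F.P J) 0)
    (hcen : ∀ w : List (Letter (F.P J).d), walkEnd x₀ w = x₀ →
      ∀ M : Matrix (Fin 2) (Fin 2) ℂ, Commute ((holAt V (walk x₀ w) : Matrix.specialUnitaryGroup (Fin 2) ℂ) : Matrix (Fin 2) (Fin 2) ℂ) M)
    {δ : ℝ} (hδ : δ ≤ 2) (hV : PlaqSmall δ V) :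
    minActionRegPr F J K hJK ε₀ V = 0 := by
  obtain ⟨g, l, -, hVg⟩ := exists_gauge_seamFold_of_loopHol_central V x₀ hcen hδ hV
  have hVg' : V = (GaugeField.gaugeAct g (l.foldr (fun (ν : Fin 3) (X : GaugeField (F.P J) 0 (Matrix.specialUnitaryGroup (Fin 2) ℂ)) => fun c : PBond (F.P J) 0 =>
            (if c.dir = ν ∧ (c.src ν).val + 1 = (F.P J).sitesPerDir 0 then (⟨-1, neg_one_mem⟩ : Matrix.specialUnitaryGroup (Fin 2) ℂ) else 1) * X c) (1 : GaugeField (F.P J) 0 (Matrix.specialUnitaryGroup (Fin 2) ℂ)))) := hVg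
  rw [hVg']
  exact minActionRegPr_seamSector_eq_zero F hJK hε₀ g l

/-- ★★★★ **EXW∘ AT EVERY CASE-B WINDOW DATUM, OUTRIGHT**: for every datum `V` whose closed-walk holonomies at a base point are central and with `PlaqSmall δ V`,
`δ ≤ 2`, and for EVERY `0 < γ ≤ 1`, `0 < b₀`, `p₀`, `0 < ε₀`, `J ≤ K` (any `L`): (E1) the regular minimum lies below the action of every good history of the
fibre, and (E2) it is attained by a (6)-regular good history — the body of `WindowExactness` at the datum, binders VERBATIM.
[cite: Balaban1985Variational, Thm 1 (8) p.279, (5)-(6) p.278; Balaban1985UV3, (7) p.257] -/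
theorem windowExactness_caseB (hJK : J ≤ K) {γ b₀ p₀ ε₀ : ℝ} (hγ : 0 < γ) (hγ1 : γ ≤ 1) (hb : 0 < b₀) (hε₀ : 0 < ε₀)
    (V : GaugeField (F.P J) 0 (Matrix.specialUnitaryGroup (Fin 2) ℂ)) (x₀ : Site (F.P J) 0)
    (hcen : ∀ w : List (Letter (F.P J).d), walkEnd x₀ w = x₀ →
      ∀ M : Matrix (Fin 2) (Fin 2) ℂ, Commute ((holAt V (walk x₀ w) : Matrix.specialUnitaryGroup (Fin 2) ℂ) : Matrix (Fin 2) (Fin 2) ℂ) M)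
    {δ : ℝ} (hδ : δ ≤ 2) (hV : PlaqSmall δ V) :
    (∀ U ∈ fibre F ℰp J K hJK V, U ∈ histGood F ℰp (θBal F.L γ b₀ p₀) K J →
        minActionRegPr F J K hJK ε₀ V ≤ wilsonAction4 U) ∧
    (∃ U₀ ∈ regFibrePr F J K hJK ε₀ V, U₀ ∈ histGood F ℰp (θBal F.L γ b₀ p₀) K J ∧
        wilsonAction4 U₀ = minActionRegPr F J K hJK ε₀ V) := by
  obtain ⟨g, l, -, hVg⟩ := exists_gauge_seamFold_of_loopHol_central V x₀ hcen hδ hV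
  have hVg' : V = (GaugeField.gaugeAct g (l.foldr (fun (ν : Fin 3) (X : GaugeField (F.P J) 0 (Matrix.specialUnitaryGroup (Fin 2) ℂ)) => fun c : PBond (F.P J) 0 =>
            (if c.dir = ν ∧ (c.src ν).val + 1 = (F.P J).sitesPerDir 0 then (⟨-1, neg_one_mem⟩ : Matrix.specialUnitaryGroup (Fin 2) ℂ) else 1) * X c) (1 : GaugeField (F.P J) 0 (Matrix.specialUnitaryGroup (Fin 2) ℂ)))) := hVg
  have h0 : minActionRegPr F J K hJK ε₀ V = 0 := by
    rw [hVg']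
    exact minActionRegPr_seamSector_eq_zero F hJK hε₀ g l
  refine ⟨fun U _ _ => ?_, ⟨(GaugeField.gaugeAct (liftTransfTo F J K hJK g) (l.foldr (fun (ν : Fin 3) (X : GaugeField (F.P K) 0 (Matrix.specialUnitaryGroup (Fin 2) ℂ)) => fun b : PBond (F.P K) 0 =>
            (if b.dir = ν ∧ (b.src ν).val + 1 = (F.P K).sitesPerDir 0 then (⟨-1, neg_one_mem⟩ : Matrix.specialUnitaryGroup (Fin 2) ℂ) else 1) * X b) (1 : GaugeField (F.P K) 0 (Matrix.specialUnitaryGroup (Fin 2) ℂ)))), ?_, ?_, ?_⟩⟩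
  · rw [h0]
    exact wilsonAction4_nonneg U
  · rw [hVg']
    exact seamSectorRep_mem_regFibrePr F hJK hε₀ g l
  · exact seamSectorRep_mem_histGood F hJK hγ hγ1 hb p₀ g l
  · rw [h0]
    exact wilsonAction4_seamSectorRep F hJK g l

end Summit.QuantumFields.YangMills.Theorems.FluctuationComparisonRegPrIntLS2BetaSeamSectorExactness

end
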